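import Summits.HodgeConjecture.HodgeConjecture.Theorems.K2E4ArchGPrimeDefs     -- ★ (this seat) the `G′`-package objects: `gState`, `stateMeasure`, `twoBlock`, `datum`, `embCircle`
import Summits.HodgeConjecture.HodgeConjecture.Theorems.K2E4ArchGStateReg      -- ★ p855166 (this seat) G3-reg `finsum_delta_mul_integral_eq_sum_relabel_pi`
import HarnessLib

/-!
# The `G′`-package, (reg): `B(∅, u)` IS the `Δ′`-weighted Haar class sum of (4.3.1) at the `G`-regular datum `u` (Rogawski 1990 §4.3 (4.3.1) p. 43, §4.1 (4.1.1) p. 39, Prop. 8.2.1 (a) p. 119)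

Track B ∕ K2-LIT, crux h413 = `stmt-HodgeConjecture-24833`; prover seat `hodgecm-mathlib-K2E4-p11` (g0), V2 «G′ PACKAGE» for the assembler K2E4-p09 (`--supports … --as helper`).
**`gState_empty_eq_finsum`** — the field `reg` of ★ `K2E4ExplicitArchSingularTransferDefs.GPrimeData` for the family `gState` of ★ `K2E4ArchGPrimeDefs`: at `S = ∅` no place is frozen
(`twoBlock ∅ u = u`, every state measure is the regular orbit measure `ν_v.map conj_{diag(ẑ_v∘ρ_v)}`, the coefficient product is empty), so `B(∅, u)` is the right-hand side of ★ G3-reg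
`K2E4ArchGStateReg.finsum_delta_mul_integral_eq_sum_relabel_pi` read backwards — the `Δ′`-weighted class sum `Σᶠ_{c″} T′.Δ(γ_H[u], out c″)·∫ b(g·out c″·g⁻¹) dν` in the Haar currency
`ν = χ • e⁻¹_*(⊗ ν_v)`, at the assembler's `H_∞`-point `(Ψ_{Q₂}⁻¹ t₂(u), e₁⁻¹ diag(σe₂))`, TOKEN FOR TOKEN the right side of `GPrimeData.reg`.
HONEST LABEL: HC_CM is proved only modulo the 7 printed citations (2 remaining named inputs: hLiu418 = `stmt-HodgeConjecture-24832`, h413 = `stmt-HodgeConjecture-24833`) until rung 0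
closes; bookkeeping, pays nothing by itself.

## References
* [Rogawski1990] J. D. Rogawski, *Automorphic Representations of Unitary Groups in Three Variables*, Ann. of Math. Stud. 123 (1990), §4.1 (4.1.1) p. 39; §4.3 (4.3.1) p. 43;
  Prop. 8.2.1 (a) pp. 118–119.
* [BorelJacquet1979] A. Borel, H. Jacquet, *Automorphic forms and automorphic representations*, PSPM 33.1 (1979), §4.1.
-/

set_option autoImplicit false
set_option linter.dupNamespace false  -- the cell's namespace convention `Summit.HodgeConjecture.HodgeConjecture.Cruxes.H413.<File>` repeats the summit = problem name

noncomputable section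

open MeasureTheory Measure Filter Topology NumberField NumberField.InfinitePlace NumberField.mixedEmbedding Equiv Function Set
open Literature.MeasureTheory.Group Literature.NumberTheory.Automorphic Literature.NumberTheory.Automorphic.UnitaryGroup
open Literature.LinearAlgebra.Matrix Literature.NumberTheory.Rogawski1990
open Summit.HodgeConjecture.HodgeConjecture.Cruxes.H413.K2E4ArchGPrimeDefs
open scoped Matrix MatrixGroups Matrix.Norms.Operator ContDiff ENNReal

namespace Summit.HodgeConjecture.HodgeConjecture.Cruxes.H413.K2E4ArchGPrimeReg

/-- A `3`-vector with pairwise distinct entries is injective. [cite: Rogawski1990, §4.1 (4.1.1) p. 39] -/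
theorem injective_vec3 {X : Type*} {a b c : X} (hab : a ≠ b) (hac : a ≠ c) (hbc : b ≠ c) : Function.Injective (![a, b, c] : Fin 3 → X) := by
  intro i j h
  fin_cases i <;> fin_cases j <;> simp_all [eq_comm]

variable (L : Type) [Field L] [NumberField L] [IsCMField L] (α : Fin 3 → L) [MeasurableSpace (GL (Fin 3) ℂ)] [BorelSpace (GL (Fin 3) ℂ)]
  [MeasurableSpace (arch (↥(maximalRealSubfield L)) L (IsCMField.complexConj L) 3 (Matrix.diagonal α))]
  [BorelSpace (arch (↥(maximalRealSubfield L)) L (IsCMField.complexConj L) 3 (Matrix.diagonal α))]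

open scoped Classical in
/-- **(reg) — `B(∅, u)` IS THE `Δ′`-WEIGHTED HAAR CLASS SUM AT THE `G`-REGULAR DATUM.**  For per-place Haar measures `νw`, a right-invariant `ν = χ • e⁻¹_*(⊗_v νw v)`, reference
measures `νH`, a transfer factor `T′`, a continuous ambient `Θ` lifting `b`, and `u` with `u_v0, u_v1, σ_v e₂` pairwise distinct at every place:
`gState … T′ χ Θ ∅ u = Σᶠ_{c″} T′.Δ(γ_H[u], out c″)·∫ b(g·out c″·g⁻¹) dν` — the right-hand side of `GPrimeData.reg` verbatim.
[cite: Rogawski1990, §4.3 (4.3.1) p. 43; §4.1 (4.1.1) p. 39; Prop. 8.2.1 (a) p. 119] [cite: BorelJacquet1979, §4.1] -/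
theorem gState_empty_eq_finsum
    (hα : ∀ i, α i ≠ 0) (hherm : ∀ i, (IsCMField.complexConj L (α i) : L) = α i)
    (νw : ∀ v : {w : InfinitePlace L // IsComplex w}, Measure (archLocal L 3 (Matrix.diagonal α) v)) (hνw : ∀ v, (νw v).IsHaarMeasure ∧ (νw v).IsMulRightInvariant)
    (e₁ e₂ : L) (h₁ : (IsCMField.complexConj L e₁ : L) * e₁ = 1) (h₂ : (IsCMField.complexConj L e₂ : L) * e₂ = 1) (hne : e₁ ≠ e₂)
    [∀ (w : {w : InfinitePlace L // IsComplex w}) (τ : Perm (Fin 3)), MeasurableSpace (archLocal L 3 (Matrix.diagonal (α ∘ ⇑τ)) w ⧸ Subgroup.centralizer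
      ({(⟨circleDiagonal 3 (wallPoint L e₁ e₂ h₁ h₂ w), circleDiagonal_mem_archLocal_diagonal L 3 (α ∘ ⇑τ) w (wallPoint L e₁ e₂ h₁ h₂ w)⟩ : archLocal L 3 (Matrix.diagonal (α ∘ ⇑τ)) w)} :
        Set (archLocal L 3 (Matrix.diagonal (α ∘ ⇑τ)) w)))]
    [∀ (w : {w : InfinitePlace L // IsComplex w}) (τ : Perm (Fin 3)), BorelSpace (archLocal L 3 (Matrix.diagonal (α ∘ ⇑τ)) w ⧸ Subgroup.centralizer
      ({(⟨circleDiagonal 3 (wallPoint L e₁ e₂ h₁ h₂ w), circleDiagonal_mem_archLocal_diagonal L 3 (α ∘ ⇑τ) w (wallPoint L e₁ e₂ h₁ h₂ w)⟩ : archLocal L 3 (Matrix.diagonal (α ∘ ⇑τ)) w)} :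
        Set (archLocal L 3 (Matrix.diagonal (α ∘ ⇑τ)) w)))]
    (νH : ∀ (w : {w : InfinitePlace L // IsComplex w}) (τ : Perm (Fin 3)), Measure (Subgroup.centralizer
      ({(⟨circleDiagonal 3 (wallPoint L e₁ e₂ h₁ h₂ w), circleDiagonal_mem_archLocal_diagonal L 3 (α ∘ ⇑τ) w (wallPoint L e₁ e₂ h₁ h₂ w)⟩ : archLocal L 3 (Matrix.diagonal (α ∘ ⇑τ)) w)} :
        Set (archLocal L 3 (Matrix.diagonal (α ∘ ⇑τ)) w))))
    (hνH : ∀ w τ, (νH w τ).IsHaarMeasure ∧ (νH w τ).IsInvInvariant)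
    (ν : Measure (arch (↥(maximalRealSubfield L)) L (IsCMField.complexConj L) 3 (Matrix.diagonal α))) [ν.IsMulRightInvariant]
    (χ : ℝ≥0∞) (hν : ν = χ • (Measure.pi νw).map (archPiEquivCM 3 L (Matrix.diagonal α)).symm)
    (T' : ArchTransferFactor L (Matrix.diagonal α))
    (Θ : Matrix (Fin 3) (Fin 3) (mixedSpace L) → ℂ) (hΘ : Continuous Θ)
    (b : arch (↥(maximalRealSubfield L)) L (IsCMField.complexConj L) 3 (Matrix.diagonal α) → ℂ)
    (hb : ∀ g, b g = Θ ((g : GL (Fin 3) (mixedSpace L)) : Matrix (Fin 3) (Fin 3) (mixedSpace L)))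
    (u : {w : InfinitePlace L // IsComplex w} → Fin 2 → Circle)
    (hu : ∀ w, u w 0 ≠ u w 1 ∧ u w 0 ≠ embCircle L e₂ h₂ w ∧ u w 1 ≠ embCircle L e₂ h₂ w) :
    gState L α νw hνw e₁ e₂ h₁ h₂ hne νH hνH T' χ Θ ∅ u =
      ∑ᶠ c'' : ConjClasses (UnitaryGroup.arch (↥(maximalRealSubfield L)) L (IsCMField.complexConj L) 3 (Matrix.diagonal α)),
      T'.Δ ((unitaryGroupOfFormCongrOfEq (UnitaryGroup.conjMixed (↥(maximalRealSubfield L)) L (IsCMField.complexConj L))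
              (Matrix.GeneralLinearGroup.map (mixedEmbedding L) (Matrix.GeneralLinearGroup.mkOfDetNeZero !![(1 : L), 1; 1, -1] (UnitaryGroup.det_quasiSplitFrameTwo_ne_zero L)))
              (UnitaryGroup.archFormOf L 2 (Matrix.diagonal ![(2 : L)⁻¹, -(2 : L)⁻¹])) (UnitaryGroup.archFormOf L 2 (Matrix.of fun i j : Fin 2 => if i.val + j.val + 1 = 2 then (1 : L) else 0))
              (UnitaryGroup.formCongr_map_mixedEmbedding_archFormOf_eq L (UnitaryGroup.formCongr_quasiSplitFrameTwo_diagonal L))).symm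
              (UnitaryGroup.archDiagTorus L 2 ![(2 : L)⁻¹, -(2 : L)⁻¹] u),
            (UnitaryGroup.archPiEquivCM 1 L (Matrix.of fun i j : Fin 1 => if i.val + j.val + 1 = 1 then (1 : L) else 0)).symm fun w =>
              ⟨UnitaryGroup.circleDiagonal 1 ![(⟨w.1.embedding e₂, mem_sphere_zero_iff_norm.mpr (UnitaryGroup.norm_embedding_eq_one_of_complexConj_mul_self L e₂ h₂ w)⟩ : Circle)], UnitaryGroup.circleDiagonal_mem_archLocal_antidiagOne L w _⟩)
          (Quotient.out c'') *
        ∫ g, b (g * Quotient.out c'' * g⁻¹) ∂ν := by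
  classical
  haveI : ∀ v : {w : InfinitePlace L // IsComplex w}, (νw v).IsHaarMeasure := fun v => (hνw v).1
  -- at `S = ∅`: nothing frozen, regular orbit measures everywhere, empty coefficient product
  have htwo : twoBlock L e₁ h₁ ∅ u = u := by
    funext v; simp only [twoBlock, Finset.notMem_empty, if_false]
  have hstate : ∀ ρ : {w : InfinitePlace L // IsComplex w} → Perm (Fin 3), stateMeasure L α νw hνw e₁ e₂ h₁ h₂ hne νH hνH ∅ u ρ =
      fun v => (νw v).map fun y : archLocal L 3 (Matrix.diagonal α) v =>
        y * (⟨circleDiagonal 3 ((![u v 0, embCircle L e₂ h₂ v, u v 1] : Fin 3 → Circle) ∘ ⇑(ρ v)),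
          circleDiagonal_mem_archLocal_diagonal L 3 α v _⟩ : archLocal L 3 (Matrix.diagonal α) v) * y⁻¹ := by
    intro ρ; funext v
    simp only [stateMeasure, Finset.notMem_empty, if_false, datum, htwo]
  have hinj : ∀ v : {w : InfinitePlace L // IsComplex w}, Function.Injective ((![u v 0, embCircle L e₂ h₂ v, u v 1] : Fin 3 → Circle)) :=
    fun v => injective_vec3 (hu v).2.1 (hu v).1 (hu v).2.2.symm
  rw [K2E4ArchGStateReg.finsum_delta_mul_integral_eq_sum_relabel_pi L α hα hherm νw ν χ hν T' Θ hΘ b hb (fun v => embCircle L e₂ h₂ v) u hinj]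
  unfold gState
  refine Finset.sum_congr rfl fun ρ _ => ?_
  rw [hstate ρ, Finset.prod_empty]
  simp only [datum, relabelMultiplicity, htwo]
  ring

end Summit.HodgeConjecture.HodgeConjecture.Cruxes.H413.K2E4ArchGPrimeReg

end
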